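import Summits.CriticalPhenomena.SAWScalingLimit.Theorems.SimpleSubseqLimits.Negative.SimpleSubseqLimitsHonesty
import Summits.CriticalPhenomena.SAWScalingLimit.Theorems.SimpleSubseqLimits.Negative.SimpleSubseqLimitsNecessary
import Literature.Probability.RandomPlanarGeometry.SimpleCurves
import Literature.Probability.Percolation.QuadCrossingContinuityEventsProofs
import Literature.Probability.RandomPlanarGeometry.SimpleCurveLaws

/-!
# drefute stmt-CriticalPhenomena-4982 — the line `marked-point-revisit` RE-ASSEMBLED on the verified
open thickening: the crux from `RangeIsArc` (SHAPE, A-side) and `NearRevisitBound` (thickened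
lattice input) ALONE, kernel-checked

`simpleSubseqLimits_of_rangeIsArc_of_nearRevisitBound : RangeIsArc → NearRevisitBound → SimpleSubseqLimits`.

Ingredients, all proved in this file (refuter's drefute pass; defs verbatim from the skeleton where
they exist there): `stub_shadowing` (stub 1), `stub_markedOfShadowing` (stub 2),
`noMarkedRevisit_of_nearRevisitBound` (stub 4' — the limit passage from the OPEN thickened event,
portmanteau for open sets along the sequence + countable union over rational 5-tuples; no generic
radii, no Fubini), the free endpoint clauses, and the skeleton's composition with `hPass hOP`
replaced by the ORDER target. `NearRevisitBound` is implied by the summit conjunct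
(`nearRevisitBound_of_sawScalingLimit`, also here), so the re-assembled line is not over-strong.
What remains of the line after this file: `stub_rangeIsArc` (SHAPE from the A-side items, L) and
the lattice estimate `NearRevisitBound` itself (open; an ARC no-touch estimate, see
`DrefuteRemarks.md` R3).
-/

noncomputable section

open MeasureTheory Filter Topology Set Metric
open Literature.Probability.RandomPlanarGeometry Literature.Probability.LatticeModels
open scoped ENNReal NNReal BoundedContinuousFunction unitInterval

namespace Summit.CriticalPhenomena.SAWScalingLimit.Cruxes.SimpleSubseqLimits.MarkedPointRevisit

open Summit.CriticalPhenomena.SAWScalingLimit.Theorems.SimpleSubseqLimits.Negative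
  (ae_carrier_of_isSLELaw)

/-- verbatim from the skeleton -/
def MarkedConfig (γ : Curve ℂ) (z : ℂ) (ρ R : ℝ) (lam T : I) : Prop :=
  lam < T ∧ γ lam ∈ sphere z R ∧ (∀ u : I, lam ≤ u → u ≤ T → γ u ∈ closedBall z R) ∧
    γ T ∈ closedBall z ρ ∧ ∀ u : I, u < T → γ u ∉ closedBall z ρ

/-- verbatim from the skeleton -/
def latticeCurve {Ω : Set ℂ} {δ : ℝ} {u v : Site 2} (γ : SAW.DomainSAW Ω δ u v) : Curve ℂ :=
  ⟨γ.walk.toCurve (meshPoint δ)⟩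

theorem mk_latticeCurve {Ω : Set ℂ} {δ : ℝ} {u v : Site 2} (γ : SAW.DomainSAW Ω δ u v) :
    CurveClass.mk (latticeCurve γ) = γ.curve := rfl

/-- **The thickened event** (drefute proposal R2): a point `γ lam` of the approach path in the open
annulus `R₁ < |· - z| < R₂`, visited before the curve ever came `r₂`-close to `z`, the curve staying
inside `B(z, R₂)` from `lam` until an `r₁`-approach at `T`, and an `ε`-return to `γ lam` after `T`.
All inequalities strict. -/
def NearRevisit (γ : Curve ℂ) (z : ℂ) (r₂ r₁ R₁ R₂ ε : ℝ) : Prop :=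
  ∃ lam T t' : I, lam < T ∧ T < t' ∧ (∀ u : I, u ≤ lam → r₂ < dist (γ u) z) ∧ R₁ < dist (γ lam) z ∧
    (∀ u : I, lam ≤ u → u ≤ T → dist (γ u) z < R₂) ∧ dist (γ T) z < r₁ ∧ dist (γ t') (γ lam) < ε

/-! ## Embedding of exact configurations -/

theorem nearRevisit_of_markedConfig {γ : Curve ℂ} {z : ℂ} {ρ R r₂ r₁ R₁ R₂ ε : ℝ} {lam T t' : I}
    (h : MarkedConfig γ z ρ R lam T) (hTt : T < t') (hrev : γ t' = γ lam)
    (h₂ : r₂ < ρ) (h₁ : ρ < r₁) (hR₁ : R₁ < R) (hR₂ : R < R₂) (hε : 0 < ε) :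
    NearRevisit γ z r₂ r₁ R₁ R₂ ε := by
  obtain ⟨hlt, hsph, hin, hT, hfirst⟩ := h
  refine ⟨lam, T, t', hlt, hTt, ?_, ?_, ?_, ?_, ?_⟩
  · intro u hu
    have := hfirst u (hu.trans_lt hlt)
    rw [mem_closedBall, not_le] at this
    exact h₂.trans this
  · rw [mem_sphere] at hsph; rw [hsph]; exact hR₁
  · intro u h1 h2
    have := hin u h1 h2
    rw [mem_closedBall] at this
    exact this.trans_lt hR₂
  · rw [mem_closedBall] at hT; exact hT.trans_lt h₁
  · rw [hrev, dist_self]; exact hε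

/-! ## Invariance, sup-stability, openness -/

theorem nearRevisit_reparam {γ : Curve ℂ} {z : ℂ} {r₂ r₁ R₁ R₂ ε : ℝ}
    (h : NearRevisit γ z r₂ r₁ R₁ R₂ ε) (φ : I ≃o I) : NearRevisit (γ.reparam φ) z r₂ r₁ R₁ R₂ ε := by
  obtain ⟨lam, T, t', hlt, hTt, hfar, hann, hin, hT, hd⟩ := h
  refine ⟨φ.symm lam, φ.symm T, φ.symm t', φ.symm.lt_iff_lt.2 hlt, φ.symm.lt_iff_lt.2 hTt,
    ?_, ?_, ?_, ?_, ?_⟩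
  · intro u hu
    show r₂ < dist (γ (φ u)) z
    exact hfar (φ u) (by simpa using φ.monotone hu)
  · show R₁ < dist (γ (φ (φ.symm lam))) z; rw [φ.apply_symm_apply]; exact hann
  · intro u h1 h2
    show dist (γ (φ u)) z < R₂
    exact hin (φ u) (by simpa using φ.monotone h1) (by simpa using φ.monotone h2)
  · show dist (γ (φ (φ.symm T))) z < r₁; rw [φ.apply_symm_apply]; exact hT
  · show dist (γ (φ (φ.symm t'))) (γ (φ (φ.symm lam))) < ε
    rw [φ.apply_symm_apply, φ.apply_symm_apply]; exact hd

theorem nearRevisit_of_reparam {γ : Curve ℂ} {z : ℂ} {r₂ r₁ R₁ R₂ ε : ℝ} (φ : I ≃o I)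
    (h : NearRevisit (γ.reparam φ) z r₂ r₁ R₁ R₂ ε) : NearRevisit γ z r₂ r₁ R₁ R₂ ε := by
  have h' := nearRevisit_reparam h φ.symm
  have heq : (γ.reparam φ).reparam φ.symm = γ := by
    apply Curve.ext; ext t
    show γ (φ (φ.symm t)) = γ t
    rw [φ.apply_symm_apply]
  rwa [heq] at h'

/-- **Sup-stability**: the event, with its witnesses, survives a uniformly small perturbation. -/
theorem exists_forall_near {γ : Curve ℂ} {z : ℂ} {r₂ r₁ R₁ R₂ ε : ℝ}
    (h : NearRevisit γ z r₂ r₁ R₁ R₂ ε) :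
    ∃ η : ℝ, 0 < η ∧ ∀ γ' : Curve ℂ, (∀ t, dist (γ t) (γ' t) < η) → NearRevisit γ' z r₂ r₁ R₁ R₂ ε := by
  obtain ⟨lam, T, t', hlt, hTt, hfar, hann, hin, hT, hd⟩ := h
  set g : I → ℝ := fun u => dist (γ u) z with hg
  have hgc : Continuous g := γ.continuous.dist continuous_const
  -- slack before `lam`
  obtain ⟨u₀, hu₀, hmin⟩ := (isCompact_Icc (a := (0 : I)) (b := lam)).exists_isMinOn
    ⟨0, le_rfl, unitInterval.nonneg'⟩ hgc.continuousOn
  have hs₁ : 0 < g u₀ - r₂ := sub_pos.2 (hfar u₀ hu₀.2)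
  -- slack on `[lam, T]`
  obtain ⟨u₁, hu₁, hmax⟩ := (isCompact_Icc (a := lam) (b := T)).exists_isMaxOn
    ⟨lam, le_rfl, hlt.le⟩ hgc.continuousOn
  have hs₃ : 0 < R₂ - g u₁ := sub_pos.2 (hin u₁ hu₁.1 hu₁.2)
  have hs₂ : 0 < g lam - R₁ := sub_pos.2 hann
  have hs₄ : 0 < r₁ - g T := sub_pos.2 hT
  have hs₅ : 0 < (ε - dist (γ t') (γ lam)) / 2 := by linarith
  set η : ℝ := min (min (min (g u₀ - r₂) (g lam - R₁)) (min (R₂ - g u₁) (r₁ - g T)))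
    ((ε - dist (γ t') (γ lam)) / 2) with hη
  have hηpos : 0 < η := lt_min (lt_min (lt_min hs₁ hs₂) (lt_min hs₃ hs₄)) hs₅
  have hη₁ : η ≤ g u₀ - r₂ := (min_le_left _ _).trans ((min_le_left _ _).trans (min_le_left _ _))
  have hη₂ : η ≤ g lam - R₁ := (min_le_left _ _).trans ((min_le_left _ _).trans (min_le_right _ _))
  have hη₃ : η ≤ R₂ - g u₁ := (min_le_left _ _).trans ((min_le_right _ _).trans (min_le_left _ _))
  have hη₄ : η ≤ r₁ - g T := (min_le_left _ _).trans ((min_le_right _ _).trans (min_le_right _ _))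
  have hη₅ : η ≤ (ε - dist (γ t') (γ lam)) / 2 := min_le_right _ _
  refine ⟨η, hηpos, fun γ' hγ' => ⟨lam, T, t', hlt, hTt, ?_, ?_, ?_, ?_, ?_⟩⟩
  · intro u hu
    have h1 : g u₀ ≤ g u := hmin ⟨unitInterval.nonneg', hu⟩
    have h2 : dist (γ u) z ≤ dist (γ u) (γ' u) + dist (γ' u) z := dist_triangle _ _ _
    have h3 := hγ' u
    show r₂ < dist (γ' u) z
    change dist (γ u₀) z ≤ dist (γ u) z at h1
    linarith
  · have h2 : dist (γ lam) z ≤ dist (γ lam) (γ' lam) + dist (γ' lam) z := dist_triangle _ _ _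
    have h3 := hγ' lam
    change η ≤ dist (γ lam) z - R₁ at hη₂
    linarith
  · intro u h1 h2
    have h4 : g u ≤ g u₁ := hmax ⟨h1, h2⟩
    have h5 : dist (γ' u) z ≤ dist (γ' u) (γ u) + dist (γ u) z := dist_triangle _ _ _
    have h6 := hγ' u
    rw [dist_comm] at h6
    change dist (γ u) z ≤ dist (γ u₁) z at h4
    change η ≤ R₂ - dist (γ u₁) z at hη₃
    linarith
  · have h5 : dist (γ' T) z ≤ dist (γ' T) (γ T) + dist (γ T) z := dist_triangle _ _ _
    have h6 := hγ' T
    rw [dist_comm] at h6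
    change η ≤ r₁ - dist (γ T) z at hη₄
    linarith
  · have h7 : dist (γ' t') (γ' lam) ≤ dist (γ' t') (γ t') + dist (γ t') (γ lam) + dist (γ lam) (γ' lam) :=
      dist_triangle4 _ _ _ _
    have h8 := hγ' t'
    have h9 := hγ' lam
    rw [dist_comm] at h8
    linarith

/-- The saturated event in the class space. -/
def nearRevisitClass (z : ℂ) (r₂ r₁ R₁ R₂ ε : ℝ) : Set (CurveClass ℂ) :=
  {c | ∃ γ : Curve ℂ, CurveClass.mk γ = c ∧ NearRevisit γ z r₂ r₁ R₁ R₂ ε}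

/-- **Openness** of the saturated thickened event in `CurveClass ℂ`. -/
theorem isOpen_nearRevisitClass (z : ℂ) (r₂ r₁ R₁ R₂ ε : ℝ) :
    IsOpen (nearRevisitClass z r₂ r₁ R₁ R₂ ε) := by
  rw [Metric.isOpen_iff]
  rintro c ⟨γ, rfl, hγ⟩
  obtain ⟨η, hη, hstab⟩ := exists_forall_near hγ
  refine ⟨η, hη, fun c' hc' => ?_⟩
  obtain ⟨γ', rfl⟩ := CurveClass.surjective_mk c'
  rw [mem_ball] at hc'
  change dist (SeparationQuotient.mk γ') (SeparationQuotient.mk γ) < η at hc'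
  rw [SeparationQuotient.dist_mk, dist_comm] at hc'
  obtain ⟨φ, hφ⟩ := Curve.exists_dist_reparam_lt hc'
  have hnear : ∀ t, dist (γ t) (γ'.reparam φ t) < η := fun t =>
    (ContinuousMap.dist_apply_le_dist t).trans_lt hφ
  exact ⟨γ', rfl, nearRevisit_of_reparam φ (hstab _ hnear)⟩

/-- Every representative of a class in the event satisfies the event up to reparametrisation; in
particular THE POLYLINE of a lattice walk does whenever its class does. -/
theorem nearRevisit_of_mk_mem {γ : Curve ℂ} {z : ℂ} {r₂ r₁ R₁ R₂ ε : ℝ}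
    (h : CurveClass.mk γ ∈ nearRevisitClass z r₂ r₁ R₁ R₂ ε) : NearRevisit γ z r₂ r₁ R₁ R₂ ε := by
  obtain ⟨γ₀, h0, hγ₀⟩ := h
  obtain ⟨η, hη, hstab⟩ := exists_forall_near hγ₀
  have hd : dist γ₀ γ < η := by
    have : dist (CurveClass.mk γ₀) (CurveClass.mk γ) = 0 := by rw [h0, dist_self]
    change dist (SeparationQuotient.mk γ₀) (SeparationQuotient.mk γ) = 0 at this
    rw [SeparationQuotient.dist_mk] at this
    rw [this]; exact hη
  obtain ⟨φ, hφ⟩ := Curve.exists_dist_reparam_lt hd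
  exact nearRevisit_of_reparam φ (hstab _ fun t => (ContinuousMap.dist_apply_le_dist t).trans_lt hφ)

/-! ## The thickened lattice input is implied by the summit conjunct -/

theorem nearRevisit_mono {γ : Curve ℂ} {z : ℂ} {r₂ r₁ R₁ R₂ ε ε' : ℝ}
    (h : NearRevisit γ z r₂ r₁ R₁ R₂ ε) (hε : ε ≤ ε') : NearRevisit γ z r₂ r₁ R₁ R₂ ε' := by
  obtain ⟨lam, T, t', hlt, hTt, hfar, hann, hin, hT, hd⟩ := h
  exact ⟨lam, T, t', hlt, hTt, hfar, hann, hin, hT, hd.trans_le hε⟩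

/-- A simple class lies in the closures of the thickened events for all `ε = 1/(n+1)` only if
`R₁ ≤ r₁`. -/
theorem not_mem_closure_nearRevisitClass_forall_of_simple {z : ℂ} {r₂ r₁ R₁ R₂ : ℝ}
    (h₁ : r₁ < R₁) {c : CurveClass ℂ} (hc : c ∈ CurveClass.simple)
    (h : ∀ n : ℕ, c ∈ closure (nearRevisitClass z r₂ r₁ R₁ R₂ (1 / ((n : ℝ) + 1)))) : False := by
  obtain ⟨η, hη, rfl⟩ := hc
  have hex : ∀ n : ℕ, ∃ γ : Curve ℂ, NearRevisit γ z r₂ r₁ R₁ R₂ (1 / ((n : ℝ) + 1)) ∧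
      ∀ t, dist (η t) (γ t) < 1 / ((n : ℝ) + 1) := by
    intro n
    obtain ⟨b, hb, hd⟩ := Metric.mem_closure_iff.1 (h n) _ (by positivity : (0 : ℝ) < 1 / ((n : ℝ) + 1))
    obtain ⟨γ, rfl, hγ⟩ := hb
    change dist (SeparationQuotient.mk η) (SeparationQuotient.mk γ) < _ at hd
    rw [SeparationQuotient.dist_mk] at hd
    obtain ⟨φ, hφ⟩ := Curve.exists_dist_reparam_lt hd
    exact ⟨γ.reparam φ, nearRevisit_reparam hγ φ,
      fun t => (ContinuousMap.dist_apply_le_dist t).trans_lt hφ⟩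
  choose γ hγ hclose using hex
  choose lam T t' hlt hTt hfar hann hin hT hdist using hγ
  obtain ⟨⟨lam₀, T₀, t₀⟩, ψ, hψ, hlim⟩ :=
    CompactSpace.tendsto_subseq (fun n => (lam n, T n, t' n))
  have hlam : Tendsto (fun k => lam (ψ k)) atTop (𝓝 lam₀) :=
    (continuous_fst.tendsto _).comp hlim
  have hTl : Tendsto (fun k => T (ψ k)) atTop (𝓝 T₀) :=
    (continuous_fst.comp continuous_snd).tendsto _ |>.comp hlim
  have htl : Tendsto (fun k => t' (ψ k)) atTop (𝓝 t₀) :=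
    (continuous_snd.comp continuous_snd).tendsto _ |>.comp hlim
  have herr : Tendsto (fun k : ℕ => 1 / ((ψ k : ℝ) + 1)) atTop (𝓝 0) := by
    have h1 : Tendsto (fun k : ℕ => 1 / ((k : ℝ) + 1)) atTop (𝓝 0) :=
      tendsto_one_div_add_atTop_nhds_zero_nat
    refine squeeze_zero (fun k => by positivity) (fun k => ?_) h1
    have : (k : ℝ) ≤ ψ k := by exact_mod_cast hψ.id_le k
    exact one_div_le_one_div_of_le (by positivity) (by linarith)
  have hval : ∀ {u : ℕ → I} {u₀ : I}, Tendsto (fun k => u (ψ k)) atTop (𝓝 u₀) →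
      Tendsto (fun k => γ (ψ k) (u (ψ k))) atTop (𝓝 (η u₀)) := by
    intro u u₀ hu
    rw [tendsto_iff_dist_tendsto_zero]
    have h2 : Tendsto (fun k => dist (η (u (ψ k))) (η u₀)) atTop (𝓝 0) := by
      rw [← tendsto_iff_dist_tendsto_zero]
      exact (η.continuous.tendsto u₀).comp hu
    refine squeeze_zero (fun k => dist_nonneg) (fun k => ?_)
      (by simpa only [add_zero] using herr.add h2)
    calc dist (γ (ψ k) (u (ψ k))) (η u₀)
        ≤ dist (γ (ψ k) (u (ψ k))) (η (u (ψ k))) + dist (η (u (ψ k))) (η u₀) := dist_triangle _ _ _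
      _ ≤ 1 / ((ψ k : ℝ) + 1) + dist (η (u (ψ k))) (η u₀) := by
          gcongr; rw [dist_comm]; exact (hclose (ψ k) _).le
  have hvlam := hval hlam
  have hvT := hval hTl
  have hvt := hval htl
  have ha : R₁ ≤ dist (η lam₀) z :=
    ge_of_tendsto' (hvlam.dist tendsto_const_nhds) fun k => (hann (ψ k)).le
  have hb : dist (η T₀) z ≤ r₁ :=
    le_of_tendsto' (hvT.dist tendsto_const_nhds) fun k => (hT (ψ k)).le
  have hc' : η t₀ = η lam₀ := by
    have hh1 : Tendsto (fun k => dist (γ (ψ k) (t' (ψ k))) (γ (ψ k) (lam (ψ k)))) atTop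
        (𝓝 (dist (η t₀) (η lam₀))) := hvt.dist hvlam
    have hh2 : Tendsto (fun k => dist (γ (ψ k) (t' (ψ k))) (γ (ψ k) (lam (ψ k)))) atTop (𝓝 0) :=
      squeeze_zero (fun k => dist_nonneg) (fun k => (hdist (ψ k)).le) herr
    exact dist_eq_zero.1 (tendsto_nhds_unique hh1 hh2)
  have hd1 : lam₀ ≤ T₀ := le_of_tendsto_of_tendsto' hlam hTl fun k => (hlt (ψ k)).le
  have hd2 : T₀ ≤ t₀ := le_of_tendsto_of_tendsto' hTl htl fun k => (hTt (ψ k)).le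
  have he : t₀ = lam₀ := hη hc'
  have hTeq : T₀ = lam₀ := le_antisymm (he ▸ hd2) hd1
  rw [hTeq] at hb
  linarith

/-- **The thickened lattice input is implied by the summit conjunct** (whenever `r₁ < R₁`; the other
order relations between the radii are not even needed for this). -/
theorem nearRevisitBound_of_sawScalingLimit (hS : _root_.SAWScalingLimit) :
    ∀ (D : DobrushinDomain) (a b : ℝ → Site 2), SAW.IsEndpointApprox D a b →
      ∀ (z : ℂ) (r₂ r₁ R₁ R₂ : ℝ), r₁ < R₁ → ∀ θ : ℝ≥0∞, 0 < θ →
        ∃ ε : ℝ, 0 < ε ∧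
          limsup (fun δ : ℝ => SAW.law D.carrier δ (a δ) (b δ)
              {γ | NearRevisit (latticeCurve γ) z r₂ r₁ R₁ R₂ ε}) (𝓝[>] (0 : ℝ)) ≤ θ := by
  intro D a b hab z r₂ r₁ R₁ R₂ h₁ θ hθ
  obtain ⟨Γ, hΓ, -, hT⟩ := hS D a b hab
  haveI : Fact Literature.Probability.Process.isProjectiveLimit_preWienerMeasure :=
    ⟨isProjectiveLimit_preWienerMeasure_holds⟩
  set μ : Measure (CurveClass ℂ) := Literature.Probability.Process.preWienerMeasure.map Γ with hμdef
  have hμ : IsSLELaw ((8 : ℝ≥0) / 3) D μ := ⟨Γ, hΓ, rfl⟩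
  haveI := hμ.isProbabilityMeasure
  -- closed enlargements and their vanishing mass
  set F : ℕ → Set (CurveClass ℂ) := fun n =>
    closure (nearRevisitClass z r₂ r₁ R₁ R₂ (1 / ((n : ℝ) + 1))) with hF
  have hanti : Antitone F := by
    intro m n hmn
    have hmn' : (m : ℝ) ≤ n := by exact_mod_cast hmn
    refine closure_mono ?_
    rintro c ⟨γ, rfl, hγ⟩
    exact ⟨γ, rfl, nearRevisit_mono hγ (one_div_le_one_div_of_le (by positivity) (by linarith))⟩
  have hlimF := tendsto_measure_iInter_atTop (μ := μ)
    (fun n : ℕ => (isClosed_closure : IsClosed (F n)).measurableSet.nullMeasurableSet)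
    hanti ⟨0, measure_ne_top μ _⟩
  have h0 : μ (⋂ n : ℕ, F n) = 0 := by
    have hae := ae_carrier_of_isSLELaw hμ
    rw [ae_iff] at hae
    refine measure_mono_null (fun c hc => ?_) hae
    intro hcar
    exact not_mem_closure_nearRevisitClass_forall_of_simple h₁ hcar.1 (mem_iInter.1 hc)
  rw [h0] at hlimF
  obtain ⟨n, hn⟩ := ((tendsto_order.1 hlimF).2 θ hθ).exists
  refine ⟨1 / ((n : ℝ) + 1), by positivity, ?_⟩
  have hFc : IsClosed (F n) := isClosed_closure
  let μs : ℝ → FiniteMeasure (CurveClass ℂ) := fun δ =>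
    ⟨(SAW.law D.carrier δ (a δ) (b δ)).map (fun γ => γ.curve), inferInstance⟩
  let μf : FiniteMeasure (CurveClass ℂ) := ⟨μ, inferInstance⟩
  have hlim : Tendsto μs (𝓝[>] (0 : ℝ)) (𝓝 μf) := by
    rw [FiniteMeasure.tendsto_iff_forall_integral_tendsto]
    intro f
    have hh := hT f
    rw [← integral_map hΓ.aemeasurable f.continuous.aestronglyMeasurable] at hh
    refine hh.congr fun δ => ?_
    change _ = ∫ x, f x ∂((SAW.law D.carrier δ (a δ) (b δ)).map (fun γ => γ.curve))
    rw [integral_map (SAW.DomainSAW.measurable_of_top _).aemeasurable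
      f.continuous.aestronglyMeasurable]
  have hport := FiniteMeasure.limsup_measure_closed_le_of_tendsto hlim hFc
  have hle : ∀ δ : ℝ, SAW.law D.carrier δ (a δ) (b δ)
      {γ | NearRevisit (latticeCurve γ) z r₂ r₁ R₁ R₂ (1 / ((n : ℝ) + 1))} ≤
        ((μs δ : FiniteMeasure (CurveClass ℂ)) : Measure (CurveClass ℂ)) (F n) := by
    intro δ
    change _ ≤ ((SAW.law D.carrier δ (a δ) (b δ)).map (fun γ => γ.curve)) (F n)
    rw [Measure.map_apply (SAW.DomainSAW.measurable_of_top _) hFc.measurableSet]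
    refine measure_mono fun γ hγ => ?_
    show γ.curve ∈ F n
    rw [← mk_latticeCurve]
    exact subset_closure ⟨latticeCurve γ, rfl, hγ⟩
  calc limsup (fun δ : ℝ => SAW.law D.carrier δ (a δ) (b δ)
          {γ | NearRevisit (latticeCurve γ) z r₂ r₁ R₁ R₂ (1 / ((n : ℝ) + 1))}) (𝓝[>] (0 : ℝ))
      ≤ limsup (fun δ => ((μs δ : FiniteMeasure (CurveClass ℂ)) : Measure (CurveClass ℂ)) (F n))
          (𝓝[>] (0 : ℝ)) := limsup_le_limsup (Eventually.of_forall hle)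
    _ ≤ (μf : Measure (CurveClass ℂ)) (F n) := hport
    _ ≤ θ := hn.le


/-! ## The limit passage from the thickened input: `NearRevisitBound → NoMarkedRevisit` (stub 4') -/

/-- **The thickened lattice input** (drefute proposal R2), as a `Prop`. -/
def NearRevisitBound : Prop :=
  ∀ (D : DobrushinDomain) (a b : ℝ → Site 2), SAW.IsEndpointApprox D a b →
    ∀ (z : ℂ) (r₂ r₁ R₁ R₂ : ℝ), r₁ < R₁ → ∀ θ : ℝ≥0∞, 0 < θ →
      ∃ ε : ℝ, 0 < ε ∧
        limsup (fun δ : ℝ => SAW.law D.carrier δ (a δ) (b δ)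
            {γ | NearRevisit (latticeCurve γ) z r₂ r₁ R₁ R₂ ε}) (𝓝[>] (0 : ℝ)) ≤ θ

/-- verbatim from the skeleton (conclusion of stub 4, consumed by `crux_of_stubs`) -/
def NoMarkedRevisit : Prop :=
  ∀ (D : DobrushinDomain) (a b : ℝ → Site 2), SAW.IsEndpointApprox D a b →
    ∀ (s : ℕ → ℝ) (ν : Measure (CurveClass ℂ)), Tendsto s atTop (𝓝[>] (0 : ℝ)) →
      IsProbabilityMeasure ν →
      (∀ f : CurveClass ℂ →ᵇ ℝ,
        Tendsto (fun n => ∫ γ, f γ.curve ∂(SAW.law D.carrier (s n) (a (s n)) (b (s n)))) atTop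
          (𝓝 (∫ x, f x ∂ν))) →
      ∃ S : Set (ℂ × ℝ × ℝ), Dense S ∧
        ∀ᵐ c ∂ν, ∃ γ : Curve ℂ, CurveClass.mk γ = c ∧
          ∀ p ∈ S, ∀ lam T : I, MarkedConfig γ p.1 p.2.1 p.2.2 lam T →
            ∀ t' : I, T < t' → γ t' ≠ γ lam

/-- Rational complex numbers. -/
def ratPt (q : ℚ × ℚ) : ℂ := (q.1 : ℂ) + (q.2 : ℂ) * Complex.I

theorem denseRange_ratPt : DenseRange ratPt := by
  have h1 : DenseRange (Prod.map ((↑) : ℚ → ℝ) ((↑) : ℚ → ℝ)) :=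
    Rat.denseRange_cast.prodMap Rat.denseRange_cast
  have h2 : DenseRange (fun p : ℝ × ℝ => Complex.equivRealProdCLM.symm p) :=
    Complex.equivRealProdCLM.symm.surjective.denseRange
  have h3 := h2.comp h1 Complex.equivRealProdCLM.symm.continuous
  convert h3 using 1
  ext q
  simp [ratPt, Complex.equivRealProdCLM_symm_apply]

/-- The parameter set of the limit statement: rational centres, arbitrary radii (dense). -/
def ratParams : Set (ℂ × ℝ × ℝ) := (Set.range ratPt) ×ˢ Set.univ

theorem dense_ratParams : Dense ratParams :=
  denseRange_ratPt.prod dense_univ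

/-- Between two reals there is a rational (as a real). -/
theorem exists_rat_btwn' {x y : ℝ} (h : x < y) : ∃ q : ℚ, x < q ∧ (q : ℝ) < y := exists_rat_btwn h

/-- **Portmanteau bound for the open thickened event along the sequence**: under the weak-limit
hypothesis, `ν (nearRevisitClass …) ≤ limsup_{δ → 0⁺} P_δ[NearRevisit (polyline) …]`. -/
theorem measure_nearRevisitClass_le {D : DobrushinDomain} {a b : ℝ → Site 2} {s : ℕ → ℝ}
    {ν : Measure (CurveClass ℂ)} (hs : Tendsto s atTop (𝓝[>] (0 : ℝ))) [IsProbabilityMeasure ν]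
    (hlim : ∀ f : CurveClass ℂ →ᵇ ℝ,
      Tendsto (fun n => ∫ γ, f γ.curve ∂(SAW.law D.carrier (s n) (a (s n)) (b (s n)))) atTop
        (𝓝 (∫ x, f x ∂ν)))
    (z : ℂ) (r₂ r₁ R₁ R₂ ε : ℝ) :
    ν (nearRevisitClass z r₂ r₁ R₁ R₂ ε) ≤
      limsup (fun δ : ℝ => SAW.law D.carrier δ (a δ) (b δ)
        {γ | NearRevisit (latticeCurve γ) z r₂ r₁ R₁ R₂ ε}) (𝓝[>] (0 : ℝ)) := by
  set G := nearRevisitClass z r₂ r₁ R₁ R₂ ε with hG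
  have hGo : IsOpen G := isOpen_nearRevisitClass _ _ _ _ _ _
  let μs : ℕ → FiniteMeasure (CurveClass ℂ) := fun n =>
    ⟨(SAW.law D.carrier (s n) (a (s n)) (b (s n))).map (fun γ => γ.curve), inferInstance⟩
  let μ : FiniteMeasure (CurveClass ℂ) := ⟨ν, inferInstance⟩
  have hten : Tendsto μs atTop (𝓝 μ) := by
    rw [FiniteMeasure.tendsto_iff_forall_integral_tendsto]
    intro f
    refine (hlim f).congr fun n => ?_
    change _ = ∫ x, f x ∂((SAW.law D.carrier (s n) (a (s n)) (b (s n))).map (fun γ => γ.curve))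
    rw [integral_map (SAW.DomainSAW.measurable_of_top _).aemeasurable
      f.continuous.aestronglyMeasurable]
  have hport : (μ : Measure (CurveClass ℂ)) G ≤
      liminf (fun n => ((μs n : FiniteMeasure (CurveClass ℂ)) : Measure (CurveClass ℂ)) G) atTop :=
    Literature.Probability.Percolation.QuadCrossing.finiteMeasure_le_liminf_measure_open_of_tendsto
      hten hGo
  -- compare with the lattice event at mesh `s n`
  set f : ℝ → ℝ≥0∞ := fun δ => SAW.law D.carrier δ (a δ) (b δ)
    {γ | NearRevisit (latticeCurve γ) z r₂ r₁ R₁ R₂ ε} with hf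
  have hle : ∀ n, ((μs n : FiniteMeasure (CurveClass ℂ)) : Measure (CurveClass ℂ)) G ≤ f (s n) := by
    intro n
    change ((SAW.law D.carrier (s n) (a (s n)) (b (s n))).map (fun γ => γ.curve)) G ≤ _
    rw [Measure.map_apply (SAW.DomainSAW.measurable_of_top _) hGo.measurableSet]
    refine measure_mono fun γ hγ => ?_
    have hγ' : CurveClass.mk (latticeCurve γ) ∈ G := by rw [mk_latticeCurve]; exact hγ
    exact nearRevisit_of_mk_mem hγ'
  calc ν G = (μ : Measure (CurveClass ℂ)) G := rfl
    _ ≤ liminf (fun n => ((μs n : FiniteMeasure (CurveClass ℂ)) : Measure (CurveClass ℂ)) G)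
          atTop := hport
    _ ≤ limsup (fun n => ((μs n : FiniteMeasure (CurveClass ℂ)) : Measure (CurveClass ℂ)) G)
          atTop := liminf_le_limsup
    _ ≤ limsup (fun n => f (s n)) atTop := limsup_le_limsup (Eventually.of_forall hle)
    _ = limsup f (map s atTop) := Filter.limsup_comp f s atTop
    _ ≤ limsup f (𝓝[>] (0 : ℝ)) := limsup_le_limsup_of_le hs

/-- **Stub 4' (drefute): the thickened input gives the ORDER target of the line, softly.**
`NearRevisitBound → NoMarkedRevisit` with `NoMarkedRevisit` EXACTLY as typed in the skeleton:
`S` = rational centres × all radii; an exact marked revisit at `(z, ρ, R)` (necessarily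
`0 ≤ ρ < R`) embeds into `⋂_ε nearRevisitClass z r₂ r₁ R₁ R₂ ε` for rational
`r₂ < ρ < r₁ < R₁ < R < R₂`, whose `ν`-mass is `≤ θ` for every `θ > 0` by the portmanteau bound;
countable union. Any representative works. -/
theorem noMarkedRevisit_of_nearRevisitBound (hB : NearRevisitBound) : NoMarkedRevisit := by
  intro D a b hab s ν hs hν hlim
  haveI := hν
  refine ⟨ratParams, dense_ratParams, ?_⟩
  -- the countable family of null `G_δ` sets
  set Z : (ℚ × ℚ) → ℚ → ℚ → ℚ → ℚ → Set (CurveClass ℂ) := fun q r₂ r₁ R₁ R₂ =>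
    {c | (r₁ : ℝ) < R₁ ∧ ∀ n : ℕ, c ∈ nearRevisitClass (ratPt q) r₂ r₁ R₁ R₂ (1 / ((n : ℝ) + 1))}
    with hZ
  have hZnull : ∀ q r₂ r₁ R₁ R₂, ν (Z q r₂ r₁ R₁ R₂) = 0 := by
    intro q r₂ r₁ R₁ R₂
    by_cases h₁ : (r₁ : ℝ) < R₁
    · refine le_antisymm (le_of_forall_gt_imp_ge_of_dense fun θ hθ => ?_) bot_le
      obtain ⟨ε, hε, hbound⟩ := hB D a b hab (ratPt q) r₂ r₁ R₁ R₂ h₁ θ hθ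
      obtain ⟨n, hn⟩ := exists_nat_one_div_lt hε
      calc ν (Z q r₂ r₁ R₁ R₂)
          ≤ ν (nearRevisitClass (ratPt q) r₂ r₁ R₁ R₂ (1 / ((n : ℝ) + 1))) :=
            measure_mono fun c hc => hc.2 n
        _ ≤ ν (nearRevisitClass (ratPt q) r₂ r₁ R₁ R₂ ε) := by
            refine measure_mono ?_
            rintro c ⟨γ, rfl, hγ⟩
            exact ⟨γ, rfl, nearRevisit_mono hγ hn.le⟩
        _ ≤ _ := measure_nearRevisitClass_le hs hlim _ _ _ _ _ _
        _ ≤ θ := hbound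
    · have : Z q r₂ r₁ R₁ R₂ = ∅ := by
        ext c; simp only [hZ, mem_setOf_eq, mem_empty_iff_false, iff_false, not_and]
        exact fun h => absurd h h₁
      rw [this, measure_empty]
  set N : Set (CurveClass ℂ) := ⋃ q, ⋃ r₂, ⋃ r₁, ⋃ R₁, ⋃ R₂, Z q r₂ r₁ R₁ R₂ with hN
  have hNnull : ν N = 0 := by
    simp only [hN, measure_iUnion_null_iff]
    exact fun q r₂ r₁ R₁ R₂ => hZnull q r₂ r₁ R₁ R₂
  -- off `N`, no representative has a marked revisit at a rational centre
  filter_upwards [measure_eq_zero_iff_ae_notMem.1 hNnull] with c hc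
  obtain ⟨γ, rfl⟩ := CurveClass.surjective_mk c
  refine ⟨γ, rfl, ?_⟩
  rintro ⟨z, ρ, R⟩ ⟨⟨q, hq⟩, -⟩ lam T hmk t' hTt heq
  simp only at hq hmk
  subst hq
  apply hc
  -- radii: `0 ≤ ρ < R`
  obtain ⟨hlt, hsph, hin, hT, hfirst⟩ := hmk
  have hρR : ρ < R := by
    have h1 := hfirst lam hlt
    rw [mem_closedBall, not_le] at h1
    rw [mem_sphere] at hsph
    linarith
  -- rational sandwiches
  obtain ⟨r₂, -, hr₂⟩ := exists_rat_btwn' (show ρ - 1 < ρ by linarith)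
  obtain ⟨r₁, hr₁, hr₁'⟩ := exists_rat_btwn' (show ρ < (ρ + R) / 2 by linarith)
  obtain ⟨R₁, hR₁, hR₁'⟩ := exists_rat_btwn' (show (ρ + R) / 2 < R by linarith)
  obtain ⟨R₂, hR₂, -⟩ := exists_rat_btwn' (show R < R + 1 by linarith)
  have h₁ : (r₁ : ℝ) < R₁ := hr₁'.trans hR₁
  refine mem_iUnion.2 ⟨q, mem_iUnion.2 ⟨r₂, mem_iUnion.2 ⟨r₁, mem_iUnion.2 ⟨R₁, mem_iUnion.2
    ⟨R₂, h₁, fun n => ?_⟩⟩⟩⟩⟩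
  exact ⟨γ, rfl, nearRevisit_of_markedConfig ⟨hlt, hsph, hin, hT, hfirst⟩ hTt heq hr₂ hr₁ hR₁' hR₂
    (by positivity)⟩

/-! ## Stub 1 (PROVED) -/

/-- verbatim from the skeleton -/
def ShadowConfig (η γ : Curve ℂ) (s t y₀ y₁ : I) : Prop :=
  s < t ∧ y₀ < y₁ ∧ γ s = η y₁ ∧ (∀ r : I, r < s → γ r ≠ η y₁) ∧
    (∀ r : I, r ≤ t → ∃ y : I, y ≤ y₁ ∧ γ r = η y) ∧
    ∀ y : I, y₀ ≤ y → y < y₁ →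
      (∃ r : I, r < s ∧ γ r = η y) ∧ (∃ r' : I, s < r' ∧ r' ≤ t ∧ γ r' = η y)

/-- The configuration from a descent `p < q`, `f q < f p`, of a continuous arc coordinate `f` with
`f 0 = 0` and `γ = η ∘ f`, `η` injective. -/
theorem shadowConfig_of_descent {η γ : Curve ℂ} (hη : η.IsSimple) {f : I → I} (hf : Continuous f)
    (hγf : ∀ u, γ u = η (f u)) (hf0 : f 0 = 0) {p q : I} (hpq : p < q) (hfpq : f q < f p) :
    ∃ s t y₀ y₁ : I, ShadowConfig η γ s t y₀ y₁ := by
  -- first argmax of `f` on `[0, q]`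
  obtain ⟨m, hm, hmax⟩ := (isCompact_Icc (a := (0 : I)) (b := q)).exists_isMaxOn
    ⟨p, unitInterval.nonneg', hpq.le⟩ hf.continuousOn
  set y₁ : I := f m with hy₁
  have hle : ∀ r : I, r ≤ q → f r ≤ y₁ := fun r hr => hmax ⟨unitInterval.nonneg', hr⟩
  set S : Set I := {r | r ≤ q ∧ f r = y₁} with hS
  have hSc : IsClosed S :=
    (isClosed_le continuous_id continuous_const).inter (isClosed_eq hf continuous_const)
  obtain ⟨s, ⟨hsq, hfs⟩, hsle⟩ := hSc.isCompact.exists_isLeast ⟨m, hm.2, rfl⟩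
  have hy01 : f q < y₁ := hfpq.trans_le (hle p hpq.le)
  have hsq' : s < q := lt_of_le_of_ne hsq (by rintro rfl; exact hy01.ne hfs)
  refine ⟨s, q, f q, y₁, hsq', hy01, by rw [hγf, hfs], ?_, ?_, ?_⟩
  · intro r hrs h
    rw [hγf] at h
    have hfr : f r = y₁ := hη h
    exact absurd (hsle ⟨hrs.le.trans hsq, hfr⟩) (not_le.2 hrs)
  · intro r hr
    exact ⟨f r, hle r hr, hγf r⟩
  · intro y hy0 hy1
    constructor
    · -- before `s`: IVT on `[0, s]`
      have hIVT := intermediate_value_Icc (unitInterval.nonneg' : (0 : I) ≤ s) hf.continuousOn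
      rw [hf0, hfs] at hIVT
      obtain ⟨r, ⟨-, hrs⟩, hfr⟩ := hIVT ⟨unitInterval.nonneg', hy1.le⟩
      have hrs' : r < s := lt_of_le_of_ne hrs (by rintro rfl; exact hy1.ne (hfr.symm.trans hfs))
      exact ⟨r, hrs', by rw [hγf, hfr]⟩
    · -- after `s`: IVT on `[s, q]`
      have hIVT := intermediate_value_Icc' hsq hf.continuousOn
      rw [hfs] at hIVT
      obtain ⟨r', ⟨hsr', hr'q⟩, hfr'⟩ := hIVT ⟨hy0, hy1.le⟩
      have hsr'' : s < r' := lt_of_le_of_ne hsr' (by rintro rfl; exact hy1.ne (hfr'.symm.trans hfs))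
      exact ⟨r', hsr'', hr'q, by rw [hγf, hfr']⟩

/-- **Stub 1, proved.** Exact registered signature of `stub_shadowing`. -/
theorem stub_shadowing :
    ∀ (η γ : Curve ℂ), η.IsSimple → Set.range γ = Set.range η → γ 0 = η 0 → ¬ γ.IsFlat →
      ∃ s t y₀ y₁ : I, ShadowConfig η γ s t y₀ y₁ := by
  intro η γ hη hrange h0 hnf
  -- the arc coordinate `f = η⁻¹ ∘ γ`
  have hmem : ∀ u, γ u ∈ Set.range η := fun u => hrange ▸ Set.mem_range_self u
  let f : I → I := fun u => hη.homeomorphRange.symm ⟨γ u, hmem u⟩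
  have hf : Continuous f :=
    hη.homeomorphRange.symm.continuous.comp (γ.continuous.subtype_mk hmem)
  have hγf : ∀ u, γ u = η (f u) := fun u => by
    have h := hη.coe_homeomorphRange_apply (hη.homeomorphRange.symm ⟨γ u, hmem u⟩)
    rw [Homeomorph.apply_symm_apply] at h
    exact h
  have hf0 : f 0 = 0 := hη ((hγf 0).symm.trans h0)
  -- `f` is not monotone, since `γ` is not flat
  have hdesc : ∃ p q : I, p < q ∧ f q < f p := by
    by_contra hmono
    push Not at hmono
    apply hnf
    intro s u t hsu hut hst
    have hfst : f s = f t := hη (by rw [← hγf, ← hγf, hst])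
    have h1 : f s ≤ f u := by
      rcases eq_or_lt_of_le hsu with h | h
      · rw [h]
      · exact hmono s u h
    have h2 : f u ≤ f t := by
      rcases eq_or_lt_of_le hut with h | h
      · rw [h]
      · exact hmono u t h
    have hfu : f u = f s := le_antisymm (hfst ▸ h2) h1
    rw [hγf, hγf s, hfu]
  obtain ⟨p, q, hpq, hfpq⟩ := hdesc
  exact shadowConfig_of_descent hη hf hγf hf0 hpq hfpq

/-! ## Stub 2 (PROVED) -/

/-- The good parameter set of stub 2: centre `ρ`-close to the new extreme point `P = η y₁`, and the
`R`-ball around the centre at distance `< d = infDist P (η '' [0, y₀])` from `P`. -/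
def goodParams (P : ℂ) (d : ℝ) : Set (ℂ × ℝ × ℝ) :=
  {p | 0 < p.2.1 ∧ p.2.1 < p.2.2 ∧ dist p.1 P < p.2.1 ∧ p.2.2 + dist p.1 P < d}

theorem isOpen_goodParams (P : ℂ) (d : ℝ) : IsOpen (goodParams P d) := by
  have h1 : Continuous fun p : ℂ × ℝ × ℝ => p.2.1 := continuous_fst.comp continuous_snd
  have h2 : Continuous fun p : ℂ × ℝ × ℝ => p.2.2 := continuous_snd.comp continuous_snd
  have h3 : Continuous fun p : ℂ × ℝ × ℝ => dist p.1 P := continuous_fst.dist continuous_const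
  have h : goodParams P d = ({p | 0 < p.2.1} ∩ {p | p.2.1 < p.2.2}) ∩
      ({p | dist p.1 P < p.2.1} ∩ {p : ℂ × ℝ × ℝ | p.2.2 + dist p.1 P < d}) := by
    ext p; simp only [goodParams, mem_inter_iff, mem_setOf_eq]; tauto
  rw [h]
  exact ((isOpen_lt continuous_const h1).inter (isOpen_lt h1 h2)).inter
    ((isOpen_lt h3 h1).inter (isOpen_lt (h2.add h3) continuous_const))

theorem goodParams_nonempty (P : ℂ) {d : ℝ} (hd : 0 < d) : (goodParams P d).Nonempty :=
  ⟨(P, d / 4, d / 2), by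
    refine ⟨by positivity, by linarith, by simp; positivity, ?_⟩
    simp; linarith⟩

/-- **Stub 2, proved.** Exact registered signature of `stub_markedOfShadowing`. -/
theorem stub_markedOfShadowing :
    ∀ (η γ : Curve ℂ), η.IsSimple → Set.range γ = Set.range η → γ 0 = η 0 →
      ∀ s t y₀ y₁ : I, ShadowConfig η γ s t y₀ y₁ →
        ∃ U : Set (ℂ × ℝ × ℝ), IsOpen U ∧ U.Nonempty ∧
          ∀ p ∈ U, ∃ lam T t' : I,
            MarkedConfig γ p.1 p.2.1 p.2.2 lam T ∧ T < t' ∧ γ t' = γ lam := by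
  intro η γ hη _hrange h0 s t y₀ y₁ hcfg
  obtain ⟨hst, hy01, hγs, hfirst, hbelow, hshadow⟩ := hcfg
  -- the new extreme point and the compact initial arc
  set P : ℂ := η y₁ with hP
  set K : Set ℂ := η '' Icc 0 y₀ with hK
  have hKc : IsCompact K := isCompact_Icc.image η.continuous
  have hKne : K.Nonempty := ⟨η 0, 0, ⟨le_rfl, y₀.2.1⟩, rfl⟩
  have hPK : P ∉ K := by
    rintro ⟨y, hy, hyP⟩
    have : y = y₁ := hη hyP
    exact absurd hy.2 (this ▸ not_le.2 hy01)
  set d : ℝ := infDist P K with hd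
  have hdpos : 0 < d := (hKc.isClosed.notMem_iff_infDist_pos hKne).1 hPK
  -- points of `K` are `≥ d` away from `P`
  have hKfar : ∀ y : I, y ≤ y₀ → d ≤ dist (η y) P := fun y hy => by
    rw [dist_comm]; exact infDist_le_dist_of_mem ⟨y, ⟨y.2.1, hy⟩, rfl⟩
  refine ⟨goodParams P d, isOpen_goodParams P d, goodParams_nonempty P hdpos, ?_⟩
  rintro ⟨z, ρ, R⟩ ⟨hρ, hρR, hzP, hRd⟩
  simp only at hρ hρR hzP hRd ⊢
  -- distance to the centre along `γ`
  set g : I → ℝ := fun u => dist (γ u) z with hg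
  have hgc : Continuous g := γ.continuous.dist continuous_const
  -- `γ 0` is outside the big ball
  have hg0 : R < g 0 := by
    have h1 : d ≤ dist (γ 0) P := by rw [h0]; exact hKfar 0 y₀.2.1
    have h2 : dist (γ 0) P ≤ dist (γ 0) z + dist z P := dist_triangle _ _ _
    show R < dist (γ 0) z
    linarith
  -- `γ s = P` is inside the small ball
  have hgs : g s ≤ ρ := by
    show dist (γ s) z ≤ ρ
    rw [hγs, dist_comm]; exact hzP.le
  -- T := first hitting time of `closedBall z ρ`
  set A : Set I := {u | g u ≤ ρ} with hA
  have hAc : IsClosed A := isClosed_le hgc continuous_const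
  obtain ⟨T, hTA, hTle⟩ := hAc.isCompact.exists_isLeast ⟨s, hgs⟩
  have hTs : T ≤ s := hTle hgs
  have hT0 : 0 < T := by
    rcases eq_or_lt_of_le (unitInterval.nonneg' : (0 : I) ≤ T) with h | h
    · exact absurd (h ▸ hTA : g 0 ≤ ρ) (not_le.2 (hρR.trans hg0))
    · exact h
  -- lam := last time `≤ T` at distance `≥ R`
  set B : Set I := {u | u ≤ T ∧ R ≤ g u} with hB
  have hBc : IsClosed B := (isClosed_le continuous_id continuous_const).inter
    (isClosed_le continuous_const hgc)
  obtain ⟨lam, ⟨hlamT, hlamR⟩, hlamge⟩ := hBc.isCompact.exists_isGreatest ⟨0, unitInterval.nonneg', hg0.le⟩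
  have hgT : g T ≤ ρ := hTA
  have hlamT' : lam < T := by
    rcases eq_or_lt_of_le hlamT with h | h
    · exact absurd (h ▸ hlamR) (not_le.2 (hgT.trans_lt hρR))
    · exact h
  -- `g lam = R` by the intermediate value theorem on `[lam, T]`
  have hglam : g lam = R := by
    by_contra hne
    have hgt : R < g lam := lt_of_le_of_ne hlamR (Ne.symm hne)
    have hIVT := intermediate_value_Icc' hlamT hgc.continuousOn
      (⟨(hgT.trans hρR.le), hgt.le⟩ : R ∈ Icc (g T) (g lam))
    obtain ⟨u, ⟨hlu, huT⟩, hgu⟩ := hIVT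
    have hul : u ≤ lam := hlamge ⟨huT, hgu.ge⟩
    have : u = lam := le_antisymm hul hlu
    exact hne (this ▸ hgu)
  -- the marked configuration
  have hmk : MarkedConfig γ z ρ R lam T := by
    refine ⟨hlamT', ?_, ?_, hgT, ?_⟩
    · rw [mem_sphere]; exact hglam
    · intro u hlu huT
      rw [mem_closedBall]
      by_contra hgu
      have hgu' : R ≤ g u := (not_le.1 hgu).le
      have hul : u ≤ lam := hlamge ⟨huT, hgu'⟩
      have : u = lam := le_antisymm hul hlu
      exact hgu (by rw [this]; exact hglam.le)
    · intro u huT hgu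
      exact absurd (hTle (show g u ≤ ρ from hgu)) (not_le.2 huT)
  -- the marked point lies on the shadowed sub-arc
  have hlamt : lam ≤ t := (hlamT'.le.trans hTs).trans hst.le
  obtain ⟨y, hyle, hγlam⟩ := hbelow lam hlamt
  have hyne : y ≠ y₁ := by
    rintro rfl
    exact hfirst lam (hlamT'.trans_le hTs) hγlam
  have hylt : y < y₁ := lt_of_le_of_ne hyle hyne
  have hy0 : y₀ ≤ y := by
    by_contra hlt
    have h1 : d ≤ dist (η y) P := hKfar y (not_le.1 hlt).le
    have h2 : dist (η y) P ≤ dist (η y) z + dist z P := dist_triangle _ _ _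
    have h3 : dist (η y) z = R := by rw [← hγlam]; exact hglam
    linarith
  obtain ⟨-, r', hsr', -, hγr'⟩ := hshadow y hy0 hylt
  exact ⟨lam, T, r', hmk, hTs.trans_lt hsr', by rw [hγr', hγlam]⟩

/-! ## SHAPE target (verbatim) -/

/-- **SHAPE** (A-side, shared with the clock line `arc-range-loewner-clock`, same text): for a
subsequential weak limit `ν` of the critical SAW laws (hypotheses of the crux verbatim), `ν`-a.e.
class has the RANGE of a simple chord of `(D; a, b)` meeting `∂D` only at `a, b`. -/
def RangeIsArc : Prop :=
  ∀ (D : DobrushinDomain) (a b : ℝ → Site 2), SAW.IsEndpointApprox D a b →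
    ∀ (s : ℕ → ℝ) (ν : Measure (CurveClass ℂ)), Tendsto s atTop (𝓝[>] (0 : ℝ)) →
      IsProbabilityMeasure ν →
      (∀ f : CurveClass ℂ →ᵇ ℝ,
        Tendsto (fun n => ∫ γ, f γ.curve ∂(SAW.law D.carrier (s n) (a (s n)) (b (s n)))) atTop
          (𝓝 (∫ x, f x ∂ν))) →
      ∀ᵐ c ∂ν, ∃ c' ∈ CurveClass.simple, c'.source = D.pt 0 ∧ c'.target = D.pt 1 ∧
        c'.range ⊆ closure D.carrier ∧ c'.range ∩ frontier D.carrier ⊆ {D.pt 0, D.pt 1} ∧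
        c'.range = c.range

/-! ## Free clauses of the crux (landed as `Theorems/SimpleSubseqLimits/Negative/SimpleSubseqLimitsCore`,
re-derived here from the built `…Negative.SimpleSubseqLimitsHonesty` so that this file elaborates stand-alone) -/

section FreeClauses

open Summit.CriticalPhenomena.SAWScalingLimit.Theorems.SimpleSubseqLimits.Negative
  (WeakLimitAlong eventually_isProbabilityMeasure_of_weakLimitAlong)

variable {D : DobrushinDomain} {a b : ℝ → Site 2} {s : ℕ → ℝ} {ν : Measure (CurveClass ℂ)}

/-- Portmanteau transfer (verbatim `Negative.ae_mem_of_isClosed_of_weakLimitAlong`): if the SAW laws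
along `s n` converge weakly to the probability measure `ν` and for all large `n` EVERY SAW curve at
mesh `s n` lies in the closed set `F`, then `ν` is carried by `F`. -/
theorem ae_mem_of_isClosed_of_weakLimitAlong' {F : Set (CurveClass ℂ)} (hF : IsClosed F)
    [IsProbabilityMeasure ν] (h : WeakLimitAlong D a b s ν)
    (hmem : ∀ᶠ n in atTop, ∀ γ : SAW.DomainSAW D.carrier (s n) (a (s n)) (b (s n)), γ.curve ∈ F) :
    ∀ᵐ γ ∂ν, γ ∈ F := by
  let μs : ℕ → FiniteMeasure (CurveClass ℂ) := fun n =>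
    ⟨(SAW.law D.carrier (s n) (a (s n)) (b (s n))).map (fun γ => γ.curve), inferInstance⟩
  let μ : FiniteMeasure (CurveClass ℂ) := ⟨ν, inferInstance⟩
  have hlim : Tendsto μs atTop (𝓝 μ) := by
    rw [FiniteMeasure.tendsto_iff_forall_integral_tendsto]
    intro f
    refine (h f).congr fun n => ?_
    change _ = ∫ x, f x ∂((SAW.law D.carrier (s n) (a (s n)) (b (s n))).map (fun γ => γ.curve))
    rw [integral_map (SAW.DomainSAW.measurable_of_top _).aemeasurable
      f.continuous.aestronglyMeasurable]
  have hle := FiniteMeasure.limsup_measure_closed_le_of_tendsto hlim hF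
  have hev : ∀ᶠ n in atTop,
      ((μs n : FiniteMeasure (CurveClass ℂ)) : Measure (CurveClass ℂ)) F = 1 := by
    filter_upwards [eventually_isProbabilityMeasure_of_weakLimitAlong h, hmem] with n hn hn'
    haveI := hn.1
    change ((SAW.law D.carrier (s n) (a (s n)) (b (s n))).map (fun γ => γ.curve)) F = 1
    rw [Measure.map_apply (SAW.DomainSAW.measurable_of_top _) hF.measurableSet]
    have : (fun γ : SAW.DomainSAW D.carrier (s n) (a (s n)) (b (s n)) => γ.curve) ⁻¹' F = univ :=
      eq_univ_of_forall fun γ => hn' γ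
    rw [this, measure_univ]
  have h1 : limsup (fun n => ((μs n : FiniteMeasure (CurveClass ℂ)) : Measure (CurveClass ℂ)) F)
      atTop = 1 := by
    rw [limsup_congr hev, limsup_const]
  rw [h1] at hle
  have hνF : ν F = 1 := le_antisymm prob_le_one hle
  have hc : ν Fᶜ = 0 := (prob_compl_eq_zero_iff hF.measurableSet).2 hνF
  rw [ae_iff]
  exact hc

/-- The endpoint clauses of the crux are FREE (verbatim from `Negative/SimpleSubseqLimitsCore`): for
every subsequential weak limit `ν` along an honest endpoint approximation, `ν`-a.e. class starts at
`a = D.pt 0` and ends at `b = D.pt 1` (continuity of `source`/`target` + portmanteau; this is where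
the load-bearing fields `tendsto_fst`/`tendsto_snd` of Disproof §2 enter). -/
theorem ae_source_target_of_weakLimitAlong' (hab : SAW.IsEndpointApprox D a b)
    (hs : Tendsto s atTop (𝓝[>] (0 : ℝ))) [IsProbabilityMeasure ν] (h : WeakLimitAlong D a b s ν) :
    ∀ᵐ γ ∂ν, γ.source = D.pt 0 ∧ γ.target = D.pt 1 := by
  have hsrc : ∀ k : ℕ, ∀ᵐ γ ∂ν,
      γ ∈ {c : CurveClass ℂ | dist c.source (D.pt 0) ≤ 1 / ((k : ℝ) + 1)} := by
    intro k
    refine ae_mem_of_isClosed_of_weakLimitAlong'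
      (isClosed_le (continuous_dist.comp (CurveClass.continuous_source.prodMk continuous_const))
        continuous_const) h ?_
    have hev := (hab.tendsto_fst.comp hs).eventually
      (closedBall_mem_nhds (D.pt 0) (by positivity : (0 : ℝ) < 1 / ((k : ℝ) + 1)))
    filter_upwards [hev] with n hn γ
    simp only [SAW.DomainSAW.curve, CurveClass.source_mk, Curve.source_def]
    change dist (γ.walk.toCurve (meshPoint (s n)) 0) (D.pt 0) ≤ _
    rw [SimpleGraph.Walk.toCurve_apply_zero]
    exact hn
  have htgt : ∀ k : ℕ, ∀ᵐ γ ∂ν,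
      γ ∈ {c : CurveClass ℂ | dist c.target (D.pt 1) ≤ 1 / ((k : ℝ) + 1)} := by
    intro k
    refine ae_mem_of_isClosed_of_weakLimitAlong'
      (isClosed_le (continuous_dist.comp (CurveClass.continuous_target.prodMk continuous_const))
        continuous_const) h ?_
    have hev := (hab.tendsto_snd.comp hs).eventually
      (closedBall_mem_nhds (D.pt 1) (by positivity : (0 : ℝ) < 1 / ((k : ℝ) + 1)))
    filter_upwards [hev] with n hn γ
    simp only [SAW.DomainSAW.curve, CurveClass.target_mk, Curve.target_def]
    change dist (γ.walk.toCurve (meshPoint (s n)) 1) (D.pt 1) ≤ _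
    rw [SimpleGraph.Walk.toCurve_apply_one]
    exact hn
  rw [← ae_all_iff] at hsrc htgt
  filter_upwards [hsrc, htgt] with γ h0 h1
  refine ⟨?_, ?_⟩
  · by_contra hne
    obtain ⟨k, hk⟩ := exists_nat_one_div_lt (dist_pos.2 hne)
    exact absurd (h0 k) (not_le.2 hk)
  · by_contra hne
    obtain ⟨k, hk⟩ := exists_nat_one_div_lt (dist_pos.2 hne)
    exact absurd (h1 k) (not_le.2 hk)

end FreeClauses

/-! ## Composition on the thickened input (kernel-checked, no sorry) -/

open Summit.CriticalPhenomena.SAWScalingLimit.Theses.SAWLoopFugacityFlow (SimpleSubseqLimits)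

/-- **The re-assembled line**: SHAPE (`RangeIsArc`) and the thickened lattice input
(`NearRevisitBound`) imply the crux. Body = the skeleton's `crux_of_stubs` with the stubs 1, 2, 4'
DISCHARGED by the theorems of this file. -/
theorem simpleSubseqLimits_of_rangeIsArc_of_nearRevisitBound (hR : RangeIsArc)
    (hB : NearRevisitBound) : SimpleSubseqLimits := by
  intro D a b hab s ν hs hν hlim
  haveI := hν
  have hRν := hR D a b hab s ν hs hν hlim
  obtain ⟨S, hSd, hN⟩ := noMarkedRevisit_of_nearRevisitBound hB D a b hab s ν hs hν hlim
  have hfree := ae_source_target_of_weakLimitAlong' (ν := ν) hab hs hlim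
  filter_upwards [hRν, hN, hfree] with c hc hn hf
  obtain ⟨c', hc's, h0', h1', hcl, hfr, hrange⟩ := hc
  obtain ⟨γ, hγc, hγ⟩ := hn
  obtain ⟨hsrc, htgt⟩ := hf
  have hsimple : c ∈ CurveClass.simple := by
    by_contra hns
    obtain ⟨η, hη, hηc'⟩ := hc's
    have e1 : γ.source = D.pt 0 := by rw [← CurveClass.source_mk, hγc]; exact hsrc
    have e2 : η.source = D.pt 0 := by rw [← CurveClass.source_mk, hηc']; exact h0'
    have e3 : γ.target = D.pt 1 := by rw [← CurveClass.target_mk, hγc]; exact htgt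
    have e4 : η.target = D.pt 1 := by rw [← CurveClass.target_mk, hηc']; exact h1'
    have hγ0 : γ 0 = η 0 := e1.trans e2.symm
    have hγ1 : γ 1 = η 1 := e3.trans e4.symm
    have hrg : Set.range γ = Set.range η := by
      have h : (CurveClass.mk γ).range = (CurveClass.mk η).range := by rw [hγc, hηc', hrange]
      exact h
    have h01 : γ 0 ≠ γ 1 := by
      rw [hγ0, hγ1]
      exact fun h => zero_ne_one (hη h)
    have hflat : ¬ γ.IsFlat := by
      intro hfl
      obtain ⟨γ₀, hγ₀, -, hd⟩ := Curve.exists_isSimple_of_isFlat hfl h01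
      apply hns
      rw [← hγc, CurveClass.mk_eq_mk_iff_dist_eq_zero.2 hd]
      exact CurveClass.mk_mem_simple hγ₀
    obtain ⟨s₀, t₀, y₀, y₁, hcfg⟩ := stub_shadowing η γ hη hrg hγ0 hflat
    obtain ⟨U, hUo, hUne, hU⟩ := stub_markedOfShadowing η γ hη hrg hγ0 s₀ t₀ y₀ y₁ hcfg
    obtain ⟨p, hpS, hpU⟩ := hSd.exists_mem_open hUo hUne
    obtain ⟨lam, T, t', hmk, hTt, heq⟩ := hU p hpU
    exact hγ p hpS lam T hmk t' hTt heq
  exact ⟨hsimple, hsrc, htgt, hrange ▸ hcl, hrange ▸ hfr⟩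

end Summit.CriticalPhenomena.SAWScalingLimit.Cruxes.SimpleSubseqLimits.MarkedPointRevisit

end
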